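import Mathlib
import Summits.Ventures.PercRepro.PuncturedLYMTriplesAllkTable

/-!
# PercRepro — (SP) FOR ANY NUMBER OF PAIRWISE DISJOINT TRIPLES AT LEVEL 4: THE COLUMN IDENTITIES
(p10, gen 40)

For each of the twelve free column classes `(d1, d2)` (`d1 + 2 d2 ≤ 5`; `5 − d1 − 2 d2` free points): the `d1` rows
obtained by removing the point of a member met once (class `(d1 − 1, d2)`, direction `0`), the `2 d2` rows obtained by
removing a point of a member met twice (class `(d1 + 1, d2 − 1)`, direction `1`) and the `5 − d1 − 2d2` rows obtained by
removing a free point (class `(d1, d2)`, direction `3`) carry total weight `1`, as an identity of rational functions in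
`(n, k)` (denominators `Qp`, `Pp` nonzero).  The member columns carry `3 · (1/3) = 1`.  Nothing here asserts (SP).
-/

namespace PercRepro.PuncturedLYM.Split.TypeLift.TriplesAllK

/-- The column identity of the free column class `(0, 0)`. -/
theorem col_0_0 (n k : ℚ) (hQ : Qp n k ≠ 0) (hP : Pp n k ≠ 0) :
    5 * raw n k 0 0 3 = 1 := by
  simp (config := {decide := true}) only [raw, sel, if_true, if_false]
  field_simp
  unfold Qp Pp N0f
  ring

/-- The column identity of the free column class `(1, 0)`. -/
theorem col_1_0 (n k : ℚ) (hQ : Qp n k ≠ 0) (hP : Pp n k ≠ 0) :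
    1 * raw n k 0 0 0 + 4 * raw n k 1 0 3 = 1 := by
  simp (config := {decide := true}) only [raw, sel, if_true, if_false]
  field_simp
  unfold Qp Pp N0n N1f
  ring

/-- The column identity of the free column class `(2, 0)`. -/
theorem col_2_0 (n k : ℚ) (hQ : Qp n k ≠ 0) (hP : Pp n k ≠ 0) :
    2 * raw n k 1 0 0 + 3 * raw n k 2 0 3 = 1 := by
  simp (config := {decide := true}) only [raw, sel, if_true, if_false]
  field_simp
  unfold Qp Pp N1n N11f
  ring

/-- The column identity of the free column class `(3, 0)`. -/
theorem col_3_0 (n k : ℚ) (hQ : Qp n k ≠ 0) (hP : Pp n k ≠ 0) :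
    3 * raw n k 2 0 0 + 2 * raw n k 3 0 3 = 1 := by
  simp (config := {decide := true}) only [raw, sel, if_true, if_false]
  field_simp
  unfold Qp Pp N11n N111f
  ring

/-- The column identity of the free column class `(4, 0)`. -/
theorem col_4_0 (n k : ℚ) (hQ : Qp n k ≠ 0) (hP : Pp n k ≠ 0) :
    4 * raw n k 3 0 0 + 1 * raw n k 4 0 3 = 1 := by
  simp (config := {decide := true}) only [raw, sel, if_true, if_false]
  field_simp
  unfold Qp Pp N111n N1111f
  ring

/-- The column identity of the free column class `(5, 0)`. -/
theorem col_5_0 (n k : ℚ) (hQ : Qp n k ≠ 0) (hP : Pp n k ≠ 0) :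
    5 * raw n k 4 0 0 = 1 := by
  simp (config := {decide := true}) only [raw, sel, if_true, if_false]
  field_simp
  unfold Qp Pp N1111n
  ring

/-- The column identity of the free column class `(0, 1)`. -/
theorem col_0_1 (n k : ℚ) (hQ : Qp n k ≠ 0) (hP : Pp n k ≠ 0) :
    2 * 1 * raw n k 1 0 1 + 3 * raw n k 0 1 3 = 1 := by
  simp (config := {decide := true}) only [raw, sel, if_true, if_false]
  field_simp
  unfold Qp Pp N1s N2f
  ring

/-- The column identity of the free column class `(1, 1)`. -/
theorem col_1_1 (n k : ℚ) (hQ : Qp n k ≠ 0) (hP : Pp n k ≠ 0) :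
    1 * raw n k 0 1 0 + 2 * 1 * raw n k 2 0 1 + 2 * raw n k 1 1 3 = 1 := by
  simp (config := {decide := true}) only [raw, sel, if_true, if_false]
  field_simp
  unfold Qp Pp N2n N11s N21f
  ring

/-- The column identity of the free column class `(2, 1)`. -/
theorem col_2_1 (n k : ℚ) (hQ : Qp n k ≠ 0) (hP : Pp n k ≠ 0) :
    2 * raw n k 1 1 0 + 2 * 1 * raw n k 3 0 1 + 1 * raw n k 2 1 3 = 1 := by
  simp (config := {decide := true}) only [raw, sel, if_true, if_false]
  field_simp
  unfold Qp Pp N21n N111s N211f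
  ring

/-- The column identity of the free column class `(3, 1)`. -/
theorem col_3_1 (n k : ℚ) (hQ : Qp n k ≠ 0) (hP : Pp n k ≠ 0) :
    3 * raw n k 2 1 0 + 2 * 1 * raw n k 4 0 1 = 1 := by
  simp (config := {decide := true}) only [raw, sel, if_true, if_false]
  field_simp
  unfold Qp Pp N211n N1111s
  ring

/-- The column identity of the free column class `(0, 2)`. -/
theorem col_0_2 (n k : ℚ) (hQ : Qp n k ≠ 0) (hP : Pp n k ≠ 0) :
    2 * 2 * raw n k 1 1 1 + 1 * raw n k 0 2 3 = 1 := by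
  simp (config := {decide := true}) only [raw, sel, if_true, if_false]
  field_simp
  unfold Qp Pp N21s N22f
  ring

/-- The column identity of the free column class `(1, 2)`. -/
theorem col_1_2 (n k : ℚ) (hQ : Qp n k ≠ 0) (hP : Pp n k ≠ 0) :
    1 * raw n k 0 2 0 + 2 * 2 * raw n k 2 1 1 = 1 := by
  simp (config := {decide := true}) only [raw, sel, if_true, if_false]
  field_simp
  unfold Qp Pp N22n N211s
  ring

/-- The column identity of every free column class `(d1, d2)` with `d1 + 2 d2 ≤ 5`, in one statement. -/
theorem col_check (n k : ℚ) (hQ : Qp n k ≠ 0) (hP : Pp n k ≠ 0) (d1 d2 : ℕ) (h : d1 + 2 * d2 ≤ 5) :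
    (d1 : ℚ) * raw n k (d1 - 1) d2 0 + 2 * (d2 : ℚ) * raw n k (d1 + 1) (d2 - 1) 1 +
      ((5 : ℚ) - d1 - 2 * d2) * raw n k d1 d2 3 = 1 := by
  have h1 : d1 ≤ 5 := by omega
  have h2 : d2 ≤ 2 := by omega
  interval_cases d1 <;> interval_cases d2 <;> push_cast
  · linear_combination col_0_0 n k hQ hP
  · linear_combination col_0_1 n k hQ hP
  · linear_combination col_0_2 n k hQ hP
  · linear_combination col_1_0 n k hQ hP
  · linear_combination col_1_1 n k hQ hP
  · linear_combination col_1_2 n k hQ hP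
  · linear_combination col_2_0 n k hQ hP
  · linear_combination col_2_1 n k hQ hP
  · omega
  · linear_combination col_3_0 n k hQ hP
  · linear_combination col_3_1 n k hQ hP
  · omega
  · linear_combination col_4_0 n k hQ hP
  · omega
  · omega
  · linear_combination col_5_0 n k hQ hP
  · omega
  · omega

end PercRepro.PuncturedLYM.Split.TypeLift.TriplesAllK
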